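import Literature.AnabelianGeometry.SemiGraphs.SectionFibreWalkSteps
import Mathlib.CategoryTheory.Galois.GaloisObjects
import HarnessLib

/-!
# Cells of `𝔾_Y` over cells of `𝔾_{Y′}` along a morphism `Y → Y′` of `B(𝒢)`, and the transitive action of
# `Aut_A(Y)` on the cells of a Galois `Y` over one cell of `𝔾_A` ([SemiAnbd] Def. 2.2 (i) p. 23, Cor. 2.7 (i) p. 30)

Mochizuki, *Semi-graphs of anabelioids*, Publ. RIMS **42** (2006), §2: Def. 2.2 (i) p. 23 (the vertices /
edges of the covering semi-graph `𝔾_A` are the connected components of the `S_v` / `T_e`; a branch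
`(b, Q)` abuts to "the component under" `Q`) and the proof of Cor. 2.7 (i) p. 30 ("[as one verifies
immediately] `ℋ′` injects into `𝒢′` as a subgraph" — via the Galois group of a Galois covering permuting
its sheets) [cite: MochizukiSemiAnbd2006, Def. 2.2(i) p.23].

PROOF-ONLY (abc-iut cell, layer L3; FACT-LIST row F-1487, CLASS route, brick R6a PORT PRODUCTION, sub-bricks
(a) and (b); seat abc-iut-f-161 gen 12).  No definition, no instance, no named fact.  The cell map along
`u : Y ⟶ Y′` is the tree's `componentUnder (u.fS v)` / `componentUnder (u.fT e)` (`ComponentsReadBack.lean`).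

* `componentUnder_comp`, `componentUnder_id`, `componentUnder_injective_of_isIso` — functoriality;
* `exists_iso_over_componentUnder_eq` — (b) for Galois categories `C`, `D`, a functor `R : C ⥤ D` with a
  fibre functor `F_D` of `D` such that `R ⋙ F_D` is a fibre functor of `C` (e.g. `ρ_v`, `ρ_e` of `B(𝒢)`),
  a GALOIS object `Y`, `g : Y → A`, and two components `K, K′` of `R Y` under ONE component of `R A`:
  some automorphism `τ` of `Y` OVER `A` carries `K` to `K′`;
* `BObj.componentOver_componentUnder` — (a) the cell map commutes with "the component under" along a
  branch: the abutment of the image branch-cell is the image of the abutment.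

Nothing here takes a side on [IUTchIII] Cor. 3.12.
-/

namespace Literature.AnabelianGeometry.SemiGraphs

open CategoryTheory CategoryTheory.Limits CategoryTheory.PreGaloisCategory
open Literature.AnabelianGeometry.Anabelioids

universe w v₁ v₂ u₁ u₂ u

-- `π₀Obj` coercions / `Subobject` underlying objects, as in `ComponentsReadBack.lean`.
set_option backward.isDefEq.respectTransparency false

/-! ### Functoriality of `componentUnder` -/

section Functoriality

variable {C : Type u₁} [Category.{v₁} C] [GaloisCategory C]

/-- `componentUnder` is functorial: the component under `K` along `f ≫ g` is the component under (the
component under `K` along `f`) along `g`. [cite: MochizukiSemiAnbd2006, Def. 2.2(i) p.23] -/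
theorem componentUnder_comp {X Y Z : C} (f : X ⟶ Y) (g : Y ⟶ Z) (K : π₀Obj X) :
    componentUnder (f ≫ g) K = componentUnder g (componentUnder f K) := by
  obtain ⟨k₁, hk₁⟩ := exists_factor_componentUnder f K
  obtain ⟨k₂, hk₂⟩ := exists_factor_componentUnder g (componentUnder f K)
  exact componentUnder_eq (f ≫ g) K (k₁ ≫ k₂) (by rw [Category.assoc, hk₂, reassoc_of% hk₁])

/-- `componentUnder` along the identity is the identity. [cite: MochizukiSemiAnbd2006, Def. 2.2(i) p.23] -/
theorem componentUnder_id {X : C} (K : π₀Obj X) : componentUnder (𝟙 X) K = K :=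
  componentUnder_eq (𝟙 X) K (𝟙 _) (by rw [Category.id_comp, Category.comp_id])

/-- Along an isomorphism the cell map is injective. [cite: MochizukiSemiAnbd2006, Def. 2.2(i) p.23] -/
theorem componentUnder_injective_of_isIso {X Y : C} (f : X ⟶ Y) [IsIso f] :
    Function.Injective (componentUnder f : π₀Obj X → π₀Obj Y) := fun K K' h => by
  rw [← componentUnder_id K, ← componentUnder_id K', ← IsIso.hom_inv_id f, componentUnder_comp,
    componentUnder_comp, h]

end Functoriality

/-! ### (b) `Aut_A(Y)` is transitive on the components of `R Y` over one component of `R A` -/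

section Galois

variable {C : Type u₁} [Category.{v₁} C] [GaloisCategory C] {D : Type u₂} [Category.{v₂} D]
  [GaloisCategory D]

/-- **Galois transitivity on cells over one cell** ([SemiAnbd] p. 30: the Galois group of a Galois
covering permutes its sheets over a given sheet transitively).  `R : C ⥤ D` is a functor of Galois
categories carrying a fibre functor `F_D` of `D` to a fibre functor `R ⋙ F_D` of `C` (the restrictions
`ρ_v`, `ρ_e` of `B(𝒢)`), `Y` is Galois, `g : Y → A`, and `K, K′` are connected components of `R Y` lying
under the same component of `R A` along `R g`.  Then some automorphism `τ` of `Y` with `τ ≫ g = g`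
satisfies `componentUnder (R τ) K = K′`.  (A point of `K` and a point of `K′` map to one `Aut F_D`-orbit,
the fibre of the common component; correct by an element of `Aut F_D`, then use transitivity of `Aut Y`
on the fibre of `Y` and rigidity of maps out of the connected `Y`.) [cite: MochizukiSemiAnbd2006, Cor. 2.7(i) p.30] -/
theorem exists_iso_over_componentUnder_eq (R : C ⥤ D) (FD : D ⥤ FintypeCat.{w}) [FiberFunctor FD]
    [FiberFunctor (R ⋙ FD)] {Y A : C} [IsGalois Y] (g : Y ⟶ A) (K K' : π₀Obj (R.obj Y))
    (h : componentUnder (R.map g) K = componentUnder (R.map g) K') :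
    ∃ τ : Y ≅ Y, τ.hom ≫ g = g ∧ componentUnder (R.map τ.hom) K = K' := by
  set P := componentUnder (R.map g) K with hP
  obtain ⟨f, hf⟩ := exists_factor_componentUnder (R.map g) K
  obtain ⟨f', hf'⟩ := exists_factor_componentUnder (R.map g) K'
  haveI := K.2; haveI := K'.2; haveI := P.2
  obtain ⟨k⟩ := nonempty_fiber_of_isConnected FD (K.1 : D)
  obtain ⟨k'⟩ := nonempty_fiber_of_isConnected FD (K'.1 : D)
  -- the two points of the fibre of `R Y` and their images in the fibre of `P`
  set y : FD.obj (R.obj Y) := FD.map K.1.arrow k with hy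
  set y' : FD.obj (R.obj Y) := FD.map K'.1.arrow k' with hy'
  have ha : FD.map (R.map g) y ∈ Set.range (FD.map P.1.arrow) :=
    ⟨FD.map f k, by rw [hy, ← FintypeCat.comp_apply, ← FintypeCat.comp_apply, ← FD.map_comp,
      ← FD.map_comp, hf]⟩
  have ha' : FD.map (R.map g) y' ∈ Set.range (FD.map (componentUnder (R.map g) K').1.arrow) :=
    ⟨FD.map f' k', by rw [hy', ← FintypeCat.comp_apply, ← FintypeCat.comp_apply, ← FD.map_comp,
      ← FD.map_comp, hf']⟩
  rw [← h] at ha'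
  -- correct by `σ ∈ Aut F_D` inside the orbit `F_D(P)`
  rw [range_map_arrow_eq_orbit FD P ha] at ha'
  obtain ⟨σ, hσ⟩ := MulAction.mem_orbit_iff.mp ha'
  have hσy : FD.map (R.map g) (σ • y) = FD.map (R.map g) y' := by
    have hnat := ConcreteCategory.congr_hom (σ.hom.naturality (R.map g)) y
    simp only [FintypeCat.comp_apply] at hnat
    rw [← hσ, mulAction_def, mulAction_def]
    exact hnat.symm
  have hyK : σ • y ∈ Set.range (FD.map K.1.arrow) := by
    rw [range_map_arrow_eq_orbit FD K ⟨k, hy.symm⟩]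
    exact MulAction.mem_orbit _ _
  -- `Aut Y` is transitive on the fibre `(R ⋙ F_D)(Y)`
  obtain ⟨τ, hτ⟩ := (isPretransitive_of_isGalois (R ⋙ FD) Y).exists_smul_eq (σ • y) y'
  have hτy : FD.map (R.map τ.hom) (σ • y) = y' := hτ
  refine ⟨τ, ?_, ?_⟩
  · apply evaluation_injective_of_isConnected (R ⋙ FD) Y A (σ • y)
    change FD.map (R.map (τ.hom ≫ g)) (σ • y) = FD.map (R.map g) (σ • y)
    rw [R.map_comp, FD.map_comp, FintypeCat.comp_apply, hτy, hσy]
  · obtain ⟨f'', hf''⟩ := exists_factor_componentUnder (R.map τ.hom) K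
    obtain ⟨k'', hk''⟩ := hyK
    refine component_eq_of_mem_range FD _ K' (x := y') ⟨FD.map f'' k'', ?_⟩ ⟨k', hy'.symm⟩
    rw [← hτy, ← hk'', ← FintypeCat.comp_apply, ← FintypeCat.comp_apply, ← FD.map_comp,
      ← FD.map_comp, hf'']

end Galois

/-! ### (a) The cell map commutes with "the component under" along a branch -/

namespace SemiGraphOfAnabelioids

variable {𝒢 : SemiGraphOfAnabelioids.{v₁, u₁, u}}

/-- **Abutments are functorial** ([SemiAnbd] p. 23: the branch `(b, Q)` abuts to the component under
`Q`).  For `u : Y → Y′` in `B(𝒢)`, a branch `b ∋ v`, and a component `c` of `Y_{e(b)}`: the component of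
`Y′_v` under the image cell of `c` along `b` is the image cell of the component of `Y_v` under `c`
(naturality `b^*(u_v) ≫ ψ′_b = ψ_b ≫ u_{e(b)}` on a fibre point).
[cite: MochizukiSemiAnbd2006, Def. 2.2(i) p.23] -/
theorem BObj.componentOver_componentUnder {Y Y' : 𝒢.BObj} (u : Y ⟶ Y') (b : 𝒢.graph.Branch)
    (v : 𝒢.graph.Vertex) (h : 𝒢.graph.abuts b = some v) (c : π₀Obj (Y.T (𝒢.graph.edgeOf b))) :
    Y'.componentOver b v h (componentUnder (u.fT (𝒢.graph.edgeOf b)) c) =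
      componentUnder (u.fS v) (Y.componentOver b v h c) := by
  let FE := GaloisCategory.getFiberFunctor (𝒢.E (𝒢.graph.edgeOf b))
  set p := Y.componentOver b v h c with hp
  set c' := componentUnder (u.fT (𝒢.graph.edgeOf b)) c with hc'
  set p' := componentUnder (u.fS v) p with hp'
  obtain ⟨fc, hfc⟩ := exists_factor_componentUnder (u.fT (𝒢.graph.edgeOf b)) c
  obtain ⟨fp, hfp⟩ := exists_factor_componentUnder (u.fS v) p
  -- a point of `c`, inside `ψ_b(b^* p)`
  haveI := c.2
  obtain ⟨q⟩ := nonempty_fiber_of_isConnected FE (c.1 : 𝒢.E (𝒢.graph.edgeOf b))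
  have hle : c.1 ≤ Y.branchImage b v h p.1 := Y.le_branchImage_componentOver b v h c
  haveI := Y.mono_map_arrow_comp_ψ b v h p.1
  let m := (𝒢.pull b v h).pullback.map p.1.arrow ≫ (Y.ψ b v h).hom
  have hm : Subobject.ofLEMk c.1 m hle ≫ m = c.1.arrow := Subobject.ofLEMk_comp hle
  refine Y'.componentOver_eq_of_mem_ranges b v h c' p' FE
    (FE.map (u.fT (𝒢.graph.edgeOf b)) (FE.map c.1.arrow q)) ⟨FE.map fc q, ?_⟩
    ⟨FE.map ((𝒢.pull b v h).pullback.map fp) (FE.map (Subobject.ofLEMk c.1 m hle) q), ?_⟩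
  · rw [← FintypeCat.comp_apply, ← FintypeCat.comp_apply, ← FE.map_comp, ← FE.map_comp, hfc]
  · have key : Subobject.ofLEMk c.1 m hle ≫ (𝒢.pull b v h).pullback.map fp ≫
        ((𝒢.pull b v h).pullback.map p'.1.arrow ≫ (Y'.ψ b v h).hom) =
        c.1.arrow ≫ u.fT (𝒢.graph.edgeOf b) := by
      rw [← hm, ← (𝒢.pull b v h).pullback.map_comp_assoc, hfp, Functor.map_comp_assoc, u.comm b v h]
      simp only [m, Category.assoc]
    have := congrArg (fun φ => FE.map φ q) key
    simpa only [FE.map_comp, FintypeCat.comp_apply] using this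

end SemiGraphOfAnabelioids

end Literature.AnabelianGeometry.SemiGraphs
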